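import Literature.Analysis.InnerProduct.RankOneDowndate

/-!
# The secular excess `vᵀ A⁻¹ v − 1` controls the negative eigenvalue of a rank-one downdate
# (size of the intruder eigenvalue at onset; sub-critical sandwich; multi-driver sandwich)

Topic `Literature/Analysis/InnerProduct` (companion of `RankOneDowndate` and `FiniteRankDowndate`).
Let `A` be a symmetric operator on a real inner product space whose form is nonnegative, `v` a
vector, `Q = A − |v⟩⟨v|` the rank-one DOWNDATE (`x ↦ ⟪A x, x⟫ − ⟪v, x⟫²`), `z` a witness
`A z = v`, and `s := ⟪v, z⟫` (`= vᵀ A⁻¹ v`, the secular function at `0`;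
`rankOne_downdate_indefinite_iff`: `Q` is indefinite iff `1 < s`). This file records — dimension
free, with the resolvent vector `y` (`A y + ε y = v`) and the witness `z` as hypotheses, no
inverses, no spectral theorem — how the EXCESS `s − 1` controls the size of the negative eigenvalue
`−ε` of `Q` (`A u − ⟪v, u⟫ v = −ε u`, `u ≠ 0`, `ε > 0`; unique by
`rankOne_downdate_nonneg_on_pair`), and how the DEFECT `1 − s` bounds `Q` from below before onset:

* `sq_inner_le_secular_mul_form` — `⟪v, x⟫² ≤ ⟪v, z⟫ · ⟪A x, x⟫` for every `x`
  (`(vᵀx)² ≤ (vᵀA⁻¹v)(xᵀAx)`, Cauchy–Schwarz for the form of `A`); hence the SUB-CRITICAL SANDWICH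
  `rankOne_downdate_form_ge` : `(1 − s) ⟪A x, x⟫ ≤ ⟪A x, x⟫ − ⟪v, x⟫²` (`(1 − s) A ≤ Q ≤ A` as
  forms) and `rankOne_downdate_form_ge_of_coercive` (`Q ≥ (1 − s) λ_min(A)` before onset).
* `rankOne_downdate_eig_mul_inner_le` — for ANY eigenpair `A u − ⟪v, u⟫ v = −ε u` (no sign
  conditions): `ε ⟪u, u⟫ ≤ (s − 1) ⟪A u, u⟫`; hence `ε ≤ Λ (s − 1)` when `⟪A x, x⟫ ≤ Λ ⟪x, x⟫`
  (`rankOne_downdate_eig_le_mul_excess`).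
* `inner_witness_eq_inner_resolvent_add` — `⟪v, z⟫ = ⟪v, y⟫ + ε ⟪y, z⟫` (first resolvent identity
  paired with `v`), and the EXCESS IDENTITY at the negative eigenvalue
  `rankOne_downdate_secular_excess_eq` : `s − 1 = ε ⟪y, z⟫` (secular equation `⟪v, y⟫ = 1`).
* `inner_resolvent_self_le_inner_witness`, `inner_resolvent_witness_le_inner_witness_self` —
  `⟪y, y⟫ ≤ ⟪y, z⟫ ≤ ⟪z, z⟫` (`A (z − y) = ε y`, `A ≥ 0`); hence the two-sided ARRIVAL LAW
  `rankOne_downdate_eig_two_sided` : `ε ⟪y, y⟫ ≤ s − 1 ≤ ε ⟪z, z⟫`, i.e.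
  `(s − 1)/‖A⁻¹ v‖² ≤ ε ≤ (s − 1)/‖(A + ε)⁻¹ v‖²`: the negative eigenvalue is born continuously
  at the crossing `s = 1`, linearly in the excess, with slope `1/‖A⁻¹v‖²` at onset.
* `rankOne_downdate_mul_excess_le_eig` — `β (s − 1) ≤ ε` when `0 ≤ β` and `β ⟪x, x⟫ ≤ ⟪A x, x⟫`
  (`ε ≥ λ_min(A) · (s − 1)`).
* `sum_sq_inner_le_mul_form_of_capacitance_le`, `finiteRank_downdate_form_ge` — the multi-driver
  sandwich: if `A zᵢ = vᵢ` and the capacitance Gram form obeys `∑ᵢ∑ⱼ cᵢ cⱼ ⟪vᵢ, zⱼ⟫ ≤ θ ∑ᵢ cᵢ²`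
  for all `c` (`Vᵀ A⁻¹ V ≤ θ`), then `∑ᵢ ⟪vᵢ, x⟫² ≤ θ ⟪A x, x⟫` and
  `(1 − θ) ⟪A x, x⟫ ≤ ⟪A x, x⟫ − ∑ᵢ ⟪vᵢ, x⟫²`.

All of this is the elementary perturbation theory of the symmetric rank-one modification —
Golub–Van Loan, *Matrix Computations* (4th ed.) §8.4.3, Theorem 8.4.3 (the secular function
`f(λ) = 1 + ρ zᵀ (D − λ I)⁻¹ z`; here `ρ = −1`, `f(0) = 1 − s`, and `f(−ε) = 0` at the negative
eigenvalue) and Bunch–Nielsen–Sorensen (1978) — combined with Cauchy–Schwarz for the nonnegative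
form of `A` (`sq_inner_le_of_nonneg_form`; the `A`/`A⁻¹` Cauchy–Schwarz inequality
`(vᵀx)² ≤ (vᵀA⁻¹v)(xᵀAx)` is the positivity of the bordered compression, Horn–Johnson Thm 7.7.7)
and the Schur-complement / capacitance bookkeeping of Haynsworth's inertia formula; written as
one-line inequalities. No definitions, no named facts; sorry-free.

Motivation (pub-rhpf cell THEORY-3, "the intruder is the resolvent-filtered shadow of an off-line
zero"; mechanism/rigidity campaign, no RH claims): for a windowed Weil form `A − 4|d⟩⟨d|` with one
off-line zero quadruple (`RankOneDowndate`, module docstring) these lemmas say that the SIZE of the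
first negative eigenvalue is the capacitance excess `4 dᵀA⁻¹d − 1` times a scale of `A` between
`λ_min(A)` and `‖A‖` (two-sidedly between `1/‖A⁻¹v‖²` and `1/‖(A+ε)⁻¹v‖²`, `v = 2d`), and that
before the crossing the window is bounded below by `(1 − 4 dᵀA⁻¹d) A`. Abstract linear algebra only.

## References
* G. H. Golub, C. F. Van Loan, *Matrix Computations*, 4th ed., Johns Hopkins (2013), §8.4.3,
  Thm 8.4.3. [GolubVanLoan2013]
* J. R. Bunch, C. P. Nielsen, D. C. Sorensen, Rank-one modification of the symmetric eigenproblem,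
  Numer. Math. 31 (1978) 31–48, doi:10.1007/BF01396012. [BunchNielsenSorensen1978]
* R. A. Horn, C. R. Johnson, *Matrix Analysis*, 2nd ed., CUP (2013), Thm 7.7.7. [HornJohnson2013]
* E. V. Haynsworth, Determination of the inertia of a partitioned Hermitian matrix, Linear Algebra
  Appl. 1 (1968) 73–81. [Haynsworth1968]
-/

noncomputable section

open scoped InnerProductSpace RealInnerProductSpace BigOperators

namespace Literature.Analysis.InnerProduct

variable {E : Type*} [NormedAddCommGroup E] [InnerProductSpace ℝ E]

/-! ## Cauchy–Schwarz with a witness and the sub-critical sandwich -/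

/-- Cauchy–Schwarz with a witness: if `A` is symmetric with nonnegative form and `A z = v`, then
`⟪v, x⟫² ≤ ⟪v, z⟫ · ⟪A x, x⟫` for every `x` (`(vᵀx)² ≤ (vᵀA⁻¹v)(xᵀAx)`).
[cite: HornJohnson2013, Thm 7.7.7] -/
theorem sq_inner_le_secular_mul_form (A : E →ₗ[ℝ] E)
    (hsym : ∀ x y : E, ⟪A x, y⟫_ℝ = ⟪x, A y⟫_ℝ) (hpos : ∀ x : E, 0 ≤ ⟪A x, x⟫_ℝ)
    {v z : E} (hz : A z = v) (x : E) :
    ⟪v, x⟫_ℝ ^ 2 ≤ ⟪v, z⟫_ℝ * ⟪A x, x⟫_ℝ := by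
  have hcs := sq_inner_le_of_nonneg_form A hsym ⊤ (fun y _ => hpos y)
    (Submodule.mem_top : z ∈ ⊤) (Submodule.mem_top : x ∈ ⊤)
  rw [hz] at hcs
  exact hcs

/-- **Sub-critical sandwich**: with `A z = v`, `(1 − ⟪v, z⟫) ⟪A x, x⟫ ≤ ⟪A x, x⟫ − ⟪v, x⟫²` for every
`x`; i.e. `(1 − vᵀA⁻¹v) A ≤ A − |v⟩⟨v| ≤ A` as quadratic forms: before onset (`vᵀA⁻¹v < 1`) the
downdate is bounded below by a positive multiple of `A`. [cite: HornJohnson2013, Thm 7.7.7] -/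
theorem rankOne_downdate_form_ge (A : E →ₗ[ℝ] E)
    (hsym : ∀ x y : E, ⟪A x, y⟫_ℝ = ⟪x, A y⟫_ℝ) (hpos : ∀ x : E, 0 ≤ ⟪A x, x⟫_ℝ)
    {v z : E} (hz : A z = v) (x : E) :
    (1 - ⟪v, z⟫_ℝ) * ⟪A x, x⟫_ℝ ≤ ⟪A x, x⟫_ℝ - ⟪v, x⟫_ℝ ^ 2 := by
  have h := sq_inner_le_secular_mul_form A hsym hpos hz x
  nlinarith [h]

/-- Coercive corollary: if moreover `β ⟪x, x⟫ ≤ ⟪A x, x⟫` for all `x` and `⟪v, z⟫ ≤ 1`, then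
`(1 − ⟪v, z⟫) β ⟪x, x⟫ ≤ ⟪A x, x⟫ − ⟪v, x⟫²`: before onset the bottom of the downdated form is at
least `(1 − vᵀA⁻¹v) · λ_min(A)`. [cite: HornJohnson2013, Thm 7.7.7] -/
theorem rankOne_downdate_form_ge_of_coercive (A : E →ₗ[ℝ] E)
    (hsym : ∀ x y : E, ⟪A x, y⟫_ℝ = ⟪x, A y⟫_ℝ) (hpos : ∀ x : E, 0 ≤ ⟪A x, x⟫_ℝ)
    {v z : E} (hz : A z = v) {β : ℝ} (hβ : ∀ x : E, β * ⟪x, x⟫_ℝ ≤ ⟪A x, x⟫_ℝ)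
    (hs : ⟪v, z⟫_ℝ ≤ 1) (x : E) :
    (1 - ⟪v, z⟫_ℝ) * (β * ⟪x, x⟫_ℝ) ≤ ⟪A x, x⟫_ℝ - ⟪v, x⟫_ℝ ^ 2 := by
  have h := rankOne_downdate_form_ge A hsym hpos hz x
  have h2 : (1 - ⟪v, z⟫_ℝ) * (β * ⟪x, x⟫_ℝ) ≤ (1 - ⟪v, z⟫_ℝ) * ⟪A x, x⟫_ℝ :=
    mul_le_mul_of_nonneg_left (hβ x) (by linarith)
  linarith

/-! ## The excess bounds the negative eigenvalue from above -/

/-- **The excess bounds the eigenvalue through the Rayleigh quotient of `A`**: for ANY eigenpair of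
the downdate, `A u − ⟪v, u⟫ v = −ε u` (no sign condition on `ε`; `u` arbitrary), and any witness
`A z = v`: `ε ⟪u, u⟫ ≤ (⟪v, z⟫ − 1) ⟪A u, u⟫`. (Pair the eigen-equation with `u`:
`⟪v, u⟫² = ⟪A u, u⟫ + ε ⟪u, u⟫`, and `⟪v, u⟫² ≤ ⟪v, z⟫ ⟪A u, u⟫.)
[cite: GolubVanLoan2013, Thm 8.4.3] -/
theorem rankOne_downdate_eig_mul_inner_le (A : E →ₗ[ℝ] E)
    (hsym : ∀ x y : E, ⟪A x, y⟫_ℝ = ⟪x, A y⟫_ℝ) (hpos : ∀ x : E, 0 ≤ ⟪A x, x⟫_ℝ)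
    {u v z : E} {ε : ℝ} (hu : A u - ⟪v, u⟫_ℝ • v = -(ε • u)) (hz : A z = v) :
    ε * ⟪u, u⟫_ℝ ≤ (⟪v, z⟫_ℝ - 1) * ⟪A u, u⟫_ℝ := by
  have h1 := sq_inner_le_secular_mul_form A hsym hpos hz u
  have h2 : ⟪A u, u⟫_ℝ - ⟪v, u⟫_ℝ * ⟪v, u⟫_ℝ = -(ε * ⟪u, u⟫_ℝ) := by
    have := congrArg (fun w => ⟪w, u⟫_ℝ) hu
    simp only [inner_sub_left, inner_neg_left, real_inner_smul_left] at this
    linarith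
  nlinarith [h1, h2]

/-- Consequently, if `0 < ε`, `u ≠ 0` and the form of `A` is bounded, `⟪A x, x⟫ ≤ Λ ⟪x, x⟫`, then
`ε ≤ Λ (⟪v, z⟫ − 1)`: the negative eigenvalue of `A − |v⟩⟨v|` is at most `‖A‖` times the secular
excess `vᵀA⁻¹v − 1` (which is then positive, cf. `rankOne_downdate_indefinite_iff`).
[cite: GolubVanLoan2013, Thm 8.4.3] -/
theorem rankOne_downdate_eig_le_mul_excess (A : E →ₗ[ℝ] E)
    (hsym : ∀ x y : E, ⟪A x, y⟫_ℝ = ⟪x, A y⟫_ℝ) (hpos : ∀ x : E, 0 ≤ ⟪A x, x⟫_ℝ)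
    {u v z : E} {ε Λ : ℝ} (hε : 0 < ε) (hu0 : u ≠ 0)
    (hu : A u - ⟪v, u⟫_ℝ • v = -(ε • u)) (hz : A z = v)
    (hΛ : ∀ x : E, ⟪A x, x⟫_ℝ ≤ Λ * ⟪x, x⟫_ℝ) :
    ε ≤ Λ * (⟪v, z⟫_ℝ - 1) := by
  have h1 := rankOne_downdate_eig_mul_inner_le A hsym hpos hu hz
  have huu : 0 < ⟪u, u⟫_ℝ := real_inner_self_pos.mpr hu0
  have hAu := hpos u
  have hs : 0 < ⟪v, z⟫_ℝ - 1 := by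
    by_contra h
    have h' := not_lt.mp h
    nlinarith
  have h2 : (⟪v, z⟫_ℝ - 1) * ⟪A u, u⟫_ℝ ≤ (⟪v, z⟫_ℝ - 1) * (Λ * ⟪u, u⟫_ℝ) :=
    mul_le_mul_of_nonneg_left (hΛ u) hs.le
  have h3 : ε * ⟪u, u⟫_ℝ ≤ (Λ * (⟪v, z⟫_ℝ - 1)) * ⟪u, u⟫_ℝ := by nlinarith
  exact le_of_mul_le_mul_right h3 huu

/-! ## The excess identity and the two-sided arrival law -/

/-- Witness identity: if `A` is symmetric, `A y + ε y = v` and `A z = v`, then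
`⟪v, z⟫ = ⟪v, y⟫ + ε ⟪y, z⟫` (`vᵀA⁻¹v = vᵀ(A+ε)⁻¹v + ε · vᵀ(A+ε)⁻¹A⁻¹v`: the first resolvent
identity paired with `v`). [folklore] -/
theorem inner_witness_eq_inner_resolvent_add (A : E →ₗ[ℝ] E)
    (hsym : ∀ x y : E, ⟪A x, y⟫_ℝ = ⟪x, A y⟫_ℝ) {v y z : E} {ε : ℝ}
    (hy : A y + ε • y = v) (hz : A z = v) :
    ⟪v, z⟫_ℝ = ⟪v, y⟫_ℝ + ε * ⟪y, z⟫_ℝ := by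
  have h1 : ⟪v, z⟫_ℝ = ⟪A y, z⟫_ℝ + ε * ⟪y, z⟫_ℝ := by
    rw [← hy, inner_add_left, real_inner_smul_left]
  rw [h1, hsym, hz, real_inner_comm v y]

/-- **Excess identity** at the negative eigenvalue: if `A ≥ 0` is symmetric, `u ≠ 0`, `ε > 0`,
`A u − ⟪v, u⟫ v = −ε u`, `A y + ε y = v` and `A z = v`, then `⟪v, z⟫ − 1 = ε ⟪y, z⟫`, i.e.
`vᵀA⁻¹v − 1 = ε · vᵀ(A + ε)⁻¹A⁻¹v` (from the secular equation `⟪v, y⟫ = 1`,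
`rankOne_downdate_secular_eq_one`). [cite: GolubVanLoan2013, Thm 8.4.3] -/
theorem rankOne_downdate_secular_excess_eq (A : E →ₗ[ℝ] E)
    (hsym : ∀ x y : E, ⟪A x, y⟫_ℝ = ⟪x, A y⟫_ℝ) (hpos : ∀ x : E, 0 ≤ ⟪A x, x⟫_ℝ)
    {u v y z : E} {ε : ℝ} (hε : 0 < ε) (hu0 : u ≠ 0)
    (hu : A u - ⟪v, u⟫_ℝ • v = -(ε • u)) (hy : A y + ε • y = v) (hz : A z = v) :
    ⟪v, z⟫_ℝ - 1 = ε * ⟪y, z⟫_ℝ := by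
  have h1 := inner_witness_eq_inner_resolvent_add A hsym hy hz
  have h2 := rankOne_downdate_secular_eq_one A hpos hε hu0 hu hy
  linarith

/-- With `A y + ε y = v` and `A z = v` the difference of the two witnesses solves `A (z − y) = ε y`.
[folklore] -/
theorem apply_witness_sub_resolvent (A : E →ₗ[ℝ] E) {v y z : E} {ε : ℝ}
    (hy : A y + ε • y = v) (hz : A z = v) : A (z - y) = ε • y := by
  rw [map_sub, hz, ← hy]
  abel

/-- If `A ≥ 0`, `0 < ε`, `A y + ε y = v` and `A z = v`, then `⟪y, y⟫ ≤ ⟪y, z⟫`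
(`0 ≤ ⟪A (z − y), z − y⟫ = ε ⟪y, z − y⟫`). [folklore] -/
theorem inner_resolvent_self_le_inner_witness (A : E →ₗ[ℝ] E)
    (hpos : ∀ x : E, 0 ≤ ⟪A x, x⟫_ℝ) {v y z : E} {ε : ℝ} (hε : 0 < ε)
    (hy : A y + ε • y = v) (hz : A z = v) : ⟪y, y⟫_ℝ ≤ ⟪y, z⟫_ℝ := by
  have hd := apply_witness_sub_resolvent A hy hz
  have h := hpos (z - y)
  rw [hd, real_inner_smul_left, inner_sub_right] at h
  nlinarith

/-- If `A ≥ 0`, `0 < ε`, `A y + ε y = v` and `A z = v`, then `⟪y, z⟫ ≤ ⟪z, z⟫`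
(`⟪z − y, z⟫ = ‖z − y‖² + ⟪z − y, y⟫ ≥ 0`). [folklore] -/
theorem inner_resolvent_witness_le_inner_witness_self (A : E →ₗ[ℝ] E)
    (hpos : ∀ x : E, 0 ≤ ⟪A x, x⟫_ℝ) {v y z : E} {ε : ℝ} (hε : 0 < ε)
    (hy : A y + ε • y = v) (hz : A z = v) : ⟪y, z⟫_ℝ ≤ ⟪z, z⟫_ℝ := by
  have hd := apply_witness_sub_resolvent A hy hz
  have h := hpos (z - y)
  rw [hd, real_inner_smul_left, inner_sub_right] at h
  have h2 : 0 ≤ ⟪z - y, z - y⟫_ℝ := real_inner_self_nonneg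
  rw [inner_sub_left, inner_sub_right, inner_sub_right] at h2
  have h3 : ⟪z, y⟫_ℝ = ⟪y, z⟫_ℝ := real_inner_comm y z
  nlinarith

/-- **Two-sided arrival law**: under the hypotheses of `rankOne_downdate_secular_excess_eq`,
`ε ⟪y, y⟫ ≤ ⟪v, z⟫ − 1 ≤ ε ⟪z, z⟫`; i.e. the negative eigenvalue `−ε` of `A − |v⟩⟨v|` satisfies
`(vᵀA⁻¹v − 1)/‖A⁻¹v‖² ≤ ε ≤ (vᵀA⁻¹v − 1)/‖(A + ε)⁻¹v‖²`: it is born continuously at the crossing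
`vᵀA⁻¹v = 1`, to first order `ε ≈ (vᵀA⁻¹v − 1)/‖A⁻¹v‖²`. [cite: GolubVanLoan2013, Thm 8.4.3] -/
theorem rankOne_downdate_eig_two_sided (A : E →ₗ[ℝ] E)
    (hsym : ∀ x y : E, ⟪A x, y⟫_ℝ = ⟪x, A y⟫_ℝ) (hpos : ∀ x : E, 0 ≤ ⟪A x, x⟫_ℝ)
    {u v y z : E} {ε : ℝ} (hε : 0 < ε) (hu0 : u ≠ 0)
    (hu : A u - ⟪v, u⟫_ℝ • v = -(ε • u)) (hy : A y + ε • y = v) (hz : A z = v) :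
    ε * ⟪y, y⟫_ℝ ≤ ⟪v, z⟫_ℝ - 1 ∧ ⟪v, z⟫_ℝ - 1 ≤ ε * ⟪z, z⟫_ℝ := by
  have h := rankOne_downdate_secular_excess_eq A hsym hpos hε hu0 hu hy hz
  have h1 := inner_resolvent_self_le_inner_witness A hpos hε hy hz
  have h2 := inner_resolvent_witness_le_inner_witness_self A hpos hε hy hz
  have h1' := mul_le_mul_of_nonneg_left h1 hε.le
  have h2' := mul_le_mul_of_nonneg_left h2 hε.le
  constructor <;> linarith

/-- The same law in terms of the eigenvector: with `‖u‖ = 1` (so `u = ⟪v, u⟫ • y` by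
`rankOne_downdate_eigenvector_eq_smul` and `⟪v, u⟫² ‖y‖² = 1`), `ε ≤ (⟪v, z⟫ − 1) · ⟪v, u⟫²`: the
negative eigenvalue is at most the excess times the squared moment of the unit intruder against the
driver. [cite: GolubVanLoan2013, Thm 8.4.3] -/
theorem rankOne_downdate_eig_le_excess_mul_sq_moment (A : E →ₗ[ℝ] E)
    (hsym : ∀ x y : E, ⟪A x, y⟫_ℝ = ⟪x, A y⟫_ℝ) (hpos : ∀ x : E, 0 ≤ ⟪A x, x⟫_ℝ)
    {u v y z : E} {ε : ℝ} (hε : 0 < ε) (hu1 : ‖u‖ = 1)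
    (hu : A u - ⟪v, u⟫_ℝ • v = -(ε • u)) (hy : A y + ε • y = v) (hz : A z = v) :
    ε ≤ (⟪v, z⟫_ℝ - 1) * ⟪v, u⟫_ℝ ^ 2 := by
  have hu0 : u ≠ 0 := by
    intro h; rw [h, norm_zero] at hu1; exact zero_ne_one hu1
  have h := (rankOne_downdate_eig_two_sided A hsym hpos hε hu0 hu hy hz).1
  have huy := rankOne_downdate_eigenvector_eq_smul A hpos hε hu hy
  have huu : ⟪u, u⟫_ℝ = 1 := by rw [real_inner_self_eq_norm_sq, hu1]; norm_num
  have hmom : ⟪v, u⟫_ℝ ^ 2 * ⟪y, y⟫_ℝ = 1 := by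
    rw [← huu]
    conv_rhs => rw [huy]
    rw [real_inner_smul_left, real_inner_smul_right]
    ring
  have hexc : 0 ≤ ⟪v, z⟫_ℝ - 1 := by nlinarith [real_inner_self_nonneg (x := y)]
  nlinarith [mul_le_mul_of_nonneg_left h (sq_nonneg ⟪v, u⟫_ℝ)]

/-! ## The excess bounds the negative eigenvalue from below -/

/-- **Coercive lower bound**: if moreover `0 ≤ β` and `β ⟪x, x⟫ ≤ ⟪A x, x⟫` for all `x`
(`A ≥ β`), then `β (⟪v, z⟫ − 1) ≤ ε`: the negative eigenvalue of `A − |v⟩⟨v|` is at least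
`λ_min(A)` times the secular excess (`β ⟪y, z⟫ ≤ ⟪v, y⟫ = 1`, using `β ⟪A d, d⟫ ≤ ‖A d‖²` for
`d = z − y`, `A d = ε y`). [cite: GolubVanLoan2013, Thm 8.4.3] -/
theorem rankOne_downdate_mul_excess_le_eig (A : E →ₗ[ℝ] E)
    (hsym : ∀ x y : E, ⟪A x, y⟫_ℝ = ⟪x, A y⟫_ℝ) (hpos : ∀ x : E, 0 ≤ ⟪A x, x⟫_ℝ)
    {u v y z : E} {ε β : ℝ} (hε : 0 < ε) (hu0 : u ≠ 0)
    (hu : A u - ⟪v, u⟫_ℝ • v = -(ε • u)) (hy : A y + ε • y = v) (hz : A z = v)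
    (hβ0 : 0 ≤ β) (hβ : ∀ x : E, β * ⟪x, x⟫_ℝ ≤ ⟪A x, x⟫_ℝ) :
    β * (⟪v, z⟫_ℝ - 1) ≤ ε := by
  have hexc := rankOne_downdate_secular_excess_eq A hsym hpos hε hu0 hu hy hz
  have hsec := rankOne_downdate_secular_eq_one A hpos hε hu0 hu hy
  have hvy : ⟪A y, y⟫_ℝ + ε * ⟪y, y⟫_ℝ = 1 := by
    rw [← hsec]
    conv_rhs => rw [← hy]
    rw [inner_add_left, real_inner_smul_left]
  have hd := apply_witness_sub_resolvent A hy hz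
  set d := z - y with hd_def
  have hyz : ⟪y, z⟫_ℝ = ⟪y, y⟫_ℝ + ⟪y, d⟫_ℝ := by
    rw [hd_def, inner_sub_right]; ring
  have hAdd : ⟪A d, d⟫_ℝ = ε * ⟪y, d⟫_ℝ := by rw [hd, real_inner_smul_left]
  have hAdAd : ⟪A d, A d⟫_ℝ = ε * ε * ⟪y, y⟫_ℝ := by
    rw [hd, real_inner_smul_left, real_inner_smul_right]; ring
  have hkey : β * ⟪A d, d⟫_ℝ ≤ ⟪A d, A d⟫_ℝ := by
    have h1 : 0 ≤ ⟪A d - β • d, A d - β • d⟫_ℝ := real_inner_self_nonneg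
    simp only [inner_sub_left, inner_sub_right, real_inner_smul_left, real_inner_smul_right] at h1
    have h2 : β * (β * ⟪d, d⟫_ℝ) ≤ β * ⟪A d, d⟫_ℝ := mul_le_mul_of_nonneg_left (hβ d) hβ0
    have h3 : ⟪d, A d⟫_ℝ = ⟪A d, d⟫_ℝ := (hsym d d).symm
    nlinarith [h1, h2, h3]
  have h4 : β * ⟪y, d⟫_ℝ ≤ ε * ⟪y, y⟫_ℝ := by
    have : ε * (β * ⟪y, d⟫_ℝ) ≤ ε * (ε * ⟪y, y⟫_ℝ) := by nlinarith [hkey, hAdd, hAdAd]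
    exact le_of_mul_le_mul_left this hε
  have h5 : β * ⟪y, z⟫_ℝ ≤ 1 := by nlinarith [hβ y, h4, hyz, hvy]
  rw [hexc]
  nlinarith [h5, hε]

/-! ## Multi-driver sandwich -/

variable {ι : Type*} [Fintype ι]

/-- **Multi-driver Cauchy–Schwarz with witnesses**: if `A` is symmetric with nonnegative form,
`A zᵢ = vᵢ`, `0 ≤ θ`, and the capacitance Gram form is bounded by `θ`,
`∑ᵢ∑ⱼ cᵢ cⱼ ⟪vᵢ, zⱼ⟫ ≤ θ ∑ᵢ cᵢ²` for every `c` (`Vᵀ A⁻¹ V ≤ θ I`), then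
`∑ᵢ ⟪vᵢ, x⟫² ≤ θ ⟪A x, x⟫` for every `x`. [cite: Haynsworth1968, inertia additivity formula] -/
theorem sum_sq_inner_le_mul_form_of_capacitance_le (A : E →ₗ[ℝ] E)
    (hsym : ∀ x y : E, ⟪A x, y⟫_ℝ = ⟪x, A y⟫_ℝ) (hpos : ∀ x : E, 0 ≤ ⟪A x, x⟫_ℝ)
    (v z : ι → E) (hz : ∀ i, A (z i) = v i) {θ : ℝ} (hθ : 0 ≤ θ)
    (hcap : ∀ c : ι → ℝ, ∑ i, ∑ j, c i * c j * ⟪v i, z j⟫_ℝ ≤ θ * ∑ i, c i ^ 2) (x : E) :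
    ∑ i, ⟪v i, x⟫_ℝ ^ 2 ≤ θ * ⟪A x, x⟫_ℝ := by
  classical
  set w : E := ∑ j, ⟪v j, x⟫_ℝ • z j with hw
  have hAw : A w = ∑ j, ⟪v j, x⟫_ℝ • v j := by
    rw [hw, map_sum]
    exact Finset.sum_congr rfl fun j _ => by rw [map_smul, hz j]
  have h1 : ⟪A w, x⟫_ℝ = ∑ j, ⟪v j, x⟫_ℝ ^ 2 := by
    rw [hAw, sum_inner]
    exact Finset.sum_congr rfl fun j _ => by rw [real_inner_smul_left]; ring
  have h2 : ⟪A w, w⟫_ℝ = ∑ i, ∑ j, ⟪v i, x⟫_ℝ * ⟪v j, x⟫_ℝ * ⟪v i, z j⟫_ℝ := by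
    rw [hAw, sum_inner]
    refine Finset.sum_congr rfl fun i _ => ?_
    rw [real_inner_smul_left, hw, inner_sum, Finset.mul_sum]
    exact Finset.sum_congr rfl fun j _ => by rw [real_inner_smul_right]; ring
  have hcs := sq_inner_le_of_nonneg_form A hsym ⊤ (fun y _ => hpos y)
    (Submodule.mem_top : w ∈ ⊤) (Submodule.mem_top : x ∈ ⊤)
  rw [h1, h2] at hcs
  have hcapx := hcap (fun i => ⟪v i, x⟫_ℝ)
  have hax := hpos x
  set S := ∑ i, ⟪v i, x⟫_ℝ ^ 2 with hS_def
  have hS0 : 0 ≤ S := Finset.sum_nonneg fun i _ => sq_nonneg _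
  rcases hS0.eq_or_lt with hS | hS
  · rw [← hS]; exact mul_nonneg hθ hax
  · have hGa := mul_le_mul_of_nonneg_right hcapx hax
    have h3 : S * S ≤ (θ * ⟪A x, x⟫_ℝ) * S := by nlinarith [hcs, hGa]
    exact le_of_mul_le_mul_right h3 hS

/-- **Multi-driver sub-critical sandwich**: under the hypotheses of
`sum_sq_inner_le_mul_form_of_capacitance_le`, `(1 − θ) ⟪A x, x⟫ ≤ ⟪A x, x⟫ − ∑ᵢ ⟪vᵢ, x⟫²` for every
`x`: a remainder whose drivers are jointly sub-critical (`Vᵀ A⁻¹ V ≤ θ < 1`) keeps the downdated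
form bounded below by `(1 − θ) A`. [cite: Haynsworth1968, inertia additivity formula] -/
theorem finiteRank_downdate_form_ge (A : E →ₗ[ℝ] E)
    (hsym : ∀ x y : E, ⟪A x, y⟫_ℝ = ⟪x, A y⟫_ℝ) (hpos : ∀ x : E, 0 ≤ ⟪A x, x⟫_ℝ)
    (v z : ι → E) (hz : ∀ i, A (z i) = v i) {θ : ℝ} (hθ : 0 ≤ θ)
    (hcap : ∀ c : ι → ℝ, ∑ i, ∑ j, c i * c j * ⟪v i, z j⟫_ℝ ≤ θ * ∑ i, c i ^ 2) (x : E) :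
    (1 - θ) * ⟪A x, x⟫_ℝ ≤ ⟪A x, x⟫_ℝ - ∑ i, ⟪v i, x⟫_ℝ ^ 2 := by
  have h := sum_sq_inner_le_mul_form_of_capacitance_le A hsym hpos v z hz hθ hcap x
  nlinarith [h]

end Literature.Analysis.InnerProduct
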